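import Literature.NumberTheory.LFunctions.FordIncompleteBasics
import Mathlib.MeasureTheory.Integral.MeanInequalities
import HarnessLib

/-!
# Finite Hölder inequality on the unit box (for Ford's case `S₄`)

Topic `Literature/NumberTheory/LFunctions`. Everything here is PROVED.

`∫_{[0,1]^n} ∏_i Z_i^{p_i} ≤ ∏_i (∫ Z_i)^{p_i}` for continuous `Z_i ≥ 0` and exponents `p_i ≥ 0`
with `∑ p_i = 1`, derived from Mathlib's `ENNReal.lintegral_prod_norm_pow_le`. Ford uses it with
`2(s-t)` factors and all `p_i = 1/(2(s-t))` in the main case `S₄` of Lemma 4.1.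

## References

* K. Ford, Proc. London Math. Soc. (3) 85 (2002), 565–633, proof of Lemma 4.1 (case S₄,
  "by Hölder's inequality"). [Ford2002]
-/

noncomputable section

open Finset MeasureTheory
open scoped ENNReal

namespace Literature.NumberTheory.LFunctions
namespace FordVK

open VMV

/-- **Finite Hölder on the unit box.** [folklore] -/
theorem integral_prod_rpow_le_box {n : ℕ} {ι : Type*} (s : Finset ι) {Z : ι → (Fin n → ℝ) → ℝ}
    (hZ : ∀ i ∈ s, Continuous (Z i)) (hZ0 : ∀ i ∈ s, ∀ α, 0 ≤ Z i α) {p : ι → ℝ}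
    (hp : ∑ i ∈ s, p i = 1) (h2p : ∀ i ∈ s, 0 ≤ p i) :
    ∫ α in box n, ∏ i ∈ s, Z i α ^ p i ≤ ∏ i ∈ s, (∫ α in box n, Z i α) ^ p i := by
  set μ : Measure (Fin n → ℝ) := volume.restrict (box n) with hμ
  have hg0 : ∀ α, 0 ≤ ∏ i ∈ s, Z i α ^ p i := fun α =>
    prod_nonneg fun i hi => Real.rpow_nonneg (hZ0 i hi α) _
  -- the left side as a lower integral
  have hgm : AEStronglyMeasurable (fun α => ∏ i ∈ s, Z i α ^ p i) μ := by
    refine (continuous_finsetProd s fun i hi => ?_).aestronglyMeasurable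
    exact (hZ i hi).rpow_const fun α => Or.inr (h2p i hi)
  rw [integral_eq_lintegral_of_nonneg_ae (ae_of_all _ hg0) hgm]
  have e1 : ∀ α, ENNReal.ofReal (∏ i ∈ s, Z i α ^ p i) = ∏ i ∈ s, ENNReal.ofReal (Z i α) ^ p i := by
    intro α
    rw [ENNReal.ofReal_prod_of_nonneg fun i hi => Real.rpow_nonneg (hZ0 i hi α) _]
    exact prod_congr rfl fun i hi => (ENNReal.ofReal_rpow_of_nonneg (hZ0 i hi α) (h2p i hi)).symm
  simp_rw [e1]
  have hH := ENNReal.lintegral_prod_norm_pow_le (μ := μ) s (f := fun i α => ENNReal.ofReal (Z i α))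
    (fun i hi => (ENNReal.measurable_ofReal.comp (hZ i hi).measurable).aemeasurable) hp h2p
  -- the right side
  have hint : ∀ i ∈ s, Integrable (Z i) μ := fun i hi => integrableOn_box_of_continuous_real (hZ i hi)
  have e2 : ∀ i ∈ s, ∫⁻ α, ENNReal.ofReal (Z i α) ∂μ = ENNReal.ofReal (∫ α, Z i α ∂μ) := fun i hi =>
    (ofReal_integral_eq_lintegral_ofReal (hint i hi) (ae_of_all _ (hZ0 i hi))).symm
  have e3 : ∏ i ∈ s, (∫⁻ α, ENNReal.ofReal (Z i α) ∂μ) ^ p i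
      = ENNReal.ofReal (∏ i ∈ s, (∫ α, Z i α ∂μ) ^ p i) := by
    rw [ENNReal.ofReal_prod_of_nonneg fun i hi => Real.rpow_nonneg (integral_nonneg (hZ0 i hi)) _]
    refine prod_congr rfl fun i hi => ?_
    rw [e2 i hi, ← ENNReal.ofReal_rpow_of_nonneg (integral_nonneg (hZ0 i hi)) (h2p i hi)]
  rw [e3] at hH
  have hfin : ENNReal.ofReal (∏ i ∈ s, (∫ α, Z i α ∂μ) ^ p i) ≠ ∞ := ENNReal.ofReal_ne_top
  have := ENNReal.toReal_mono hfin hH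
  rwa [ENNReal.toReal_ofReal (prod_nonneg fun i hi => Real.rpow_nonneg (integral_nonneg (hZ0 i hi)) _)]
    at this

end FordVK
end Literature.NumberTheory.LFunctions
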